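import Summits.BirchSwinnertonDyer.BirchSwinnertonDyer.Theorems.CountingDoorF2AtThreeSchneiderOnDoorSubfamilyCrossTerm
import Literature.NumberTheory.EllipticCurves.CanonicalPAdicHeightThreeAdicDigitProofs
import HarnessLib

/-!
# BirchSwinnertonDyer / CountingDoorF2AtThree — crux I4loc `SchneiderOnDoorSubfamily`
# (stmt-BirchSwinnertonDyer-19682), line `valuation-class-at-three` (v3): the S3 ⇒ S4 step —
# the digit clauses of `stub_heightDigits` for a member of `F₂` from division-value congruences

Helper file (`--supports stmt-BirchSwinnertonDyer-19682 --as helper`; cell bsd-rank2, seat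
cd-valclass-sigma3, PART 1b ACCEL row (3); PARTITION: none — r_an ≥ 2, summit axis S0). For a member
`a = (a₁, a₂, a₂', a₃)` of Bhargava–Ho's family `F₂` (`Params.curve = Params.curveInt ⊗ ℚ`, marked
integral points `P₁ = (a₂, 0)`, `P₂ = (a₂', 0)`), under the line's square-free sieve
`∀ ℓ, ℓ² ∤ Δ(a)` (type ∅) and the existence of a Mazur–Tate pair for `a.curve ⊗ ℚ₃`
(`hσ : ∃ σ c, (a.curve.baseChange ℚ_[3]).IsMazurTateSigmaPair σ c` — the genuine `3`-adic sigma function;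
supplied by the named fact `mazur_tate_sigma_exists_odd` = conjunct 2 of the route's
`PublishedInputsAtThree`, see `params_exists_isMazurTateSigmaPair_of_odd`), and for THE canonical
`3`-adic height datum `Dh` on `a.curve` (`PAdicHeightData.IsCanonical`), this file gives the DIGIT
clauses of the registered stub `stub_heightDigits` of
`Cruxes/SchneiderOnDoorSubfamily/Lines/valuation_class_at_three.lean` (v3) in ONE call each, and
assembles the stub's whole height conjunction for a member:

* `params_norm_pairing_nsmul_markedPoint₁_div_three_sub_lt` — for `m : ℕ` with `3 ∣ ψₘ(P₁) ≠ 0`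
  and `d : ℤ` with `9 ∣ φₘ(P₁)² − 1 − 6d` (polynomial congruences in `a`, S4):
  **`‖Dh.pairing (m • P₁) (m • P₁) / 3 − d‖ < 1`**; `…markedPoint₂…` likewise for `n • P₂`;
* the second-order evaluations `params_norm_pairing_nsmul_markedPointᵢ_sub_padicLog_φ_le_sq`
  (**`‖Dh.pairing (m • Pᵢ) (m • Pᵢ) − log₃ φₘ(Pᵢ)‖ ≤ ‖ψₘ(Pᵢ)‖²`**, one order sharper than the
  denominator file's `params_pairing_nsmul_markedPointᵢ_at_three`);
* `params_exists_heightDigits` — on the door class `a ≡ (1, 0, 1, 0) (mod 3)` with `ψ₂(P₁) ≠ 0`,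
  `ψ₃(P₂) ≠ 0`, digits `dA, dB` with `dA·dB ≡ 2 (mod 3)`, `9 ∣ φ₂(P₁)² − 1 − 6dA`,
  `9 ∣ φ₃(P₂)² − 1 − 6dB`: the registered conjunction
  `∃ dA dB, dA * dB % 3 = 2 ∧ ‖⟨2P₁,2P₁⟩/3 − dA‖ < 1 ∧ ‖⟨3P₂,3P₂⟩/3 − dB‖ < 1 ∧ ‖⟨2P₁+3P₂, ·⟩‖ ≤ 3⁻¹`
  VERBATIM (third conjunct = the denominator seat's `params_norm_pairing_crossTerm_le`).

Everything is a specialisation of the Literature theorems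
`WeierstrassCurve.norm_pairing_zsmul_self_three_div_sub_lt` / `…_sub_padicLog_φ_le_sq`
(`CanonicalPAdicHeightThreeAdicDigitProofs`, this seat), which rest on the cancellation
`ĥ₃(P) = log₃(num x(P)) + O(‖z(P)‖²)` (`CanonicalPAdicHeightFirstOrderProofs`) and on the exact numerator
/ denominator and admissibility package of the denominator seat (`DivisionValuesSigmaFormulaProofs`,
`…SchneiderOnDoorSubfamilyDenominator`, `…CrossTerm`). With these, `stub_heightDigits` reduces to: the
family facts (S1), the polynomial facts `ψ₂(P₁) ≠ 0`, `ψ₃(P₂) ≠ 0`, `9 ∣ φ₂(P₁)² − 7`,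
`9 ∣ φ₃(P₂)² − 13` on the class `a ≡ (7,0,4,0) (mod 9)` (digits `(dA, dB) = (1, 2)`, eng-2 T12.md §4),
and the Mazur–Tate pair at `3`. B1 honesty: local `3`-adic analysis of heights of explicit points; nothing
here reads a Selmer group, an `L`-value or an analytic rank.

References: Mazur–Stein–Tate 2006 §1, Alg. 3.4 [MazurSteinTate2006]; Balakrishnan 2016 §2 (2.3)
[Balakrishnan2016]; Harvey 2008 §5 [Harvey2008]; Bhargava–Ho 2022 §1 [BhargavaHo2022].
-/

-- the summit namespace `Summit.BirchSwinnertonDyer.BirchSwinnertonDyer.Theorems` repeats a component by design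
-- (single-conjunct summit, CONVENTIONS §1), which the `dupNamespace` linter would flag on every declaration.
set_option linter.dupNamespace false

noncomputable section

open scoped Classical
open WeierstrassCurve Literature.NumberTheory.EllipticCurves
  Literature.NumberTheory.EllipticCurves.BhargavaHo2022

namespace Summit.BirchSwinnertonDyer.BirchSwinnertonDyer.Theorems

variable {a : Params}

/-! ### Second order: `⟨mPᵢ, mPᵢ⟩ = log₃ φₘ(Pᵢ) + O(ψₘ(Pᵢ)²)` -/

/-- **Second order for `P₁`**: `‖Dh.pairing (m • P₁) (m • P₁) − log₃ φₘ(P₁)‖₃ ≤ ‖ψₘ(P₁)‖₃²` for a type-∅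
member with a Mazur–Tate pair over `ℚ₃`, `3 ∣ ψₘ(P₁) ≠ 0`, `Dh` canonical (the cancellation
`ĥ₃ = log₃ num x + O(z²)`). [cite: Harvey2008, §5 (evaluation of log_p(σ_p(mQ)/d(mQ)); Lemma 8)] -/
theorem params_norm_pairing_nsmul_markedPoint₁_sub_padicLog_φ_le_sq
    (hσ : ∃ σ : PowerSeries ℚ_[3], ∃ c : ℚ_[3], (a.curve.baseChange ℚ_[3]).IsMazurTateSigmaPair σ c)
    {Dh : PAdicHeightData a.curve 3} (hDh : Dh.IsCanonical)
    (hΔ : ∀ ℓ : ℕ, ℓ.Prime → ¬ (ℓ : ℤ) ^ 2 ∣ a.curveInt.Δ) (h : a.IsMember) {m : ℕ}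
    (hψ : (a.curveInt.ψ m).evalEval a.a₂ 0 ≠ 0) (h3 : (3 : ℤ) ∣ (a.curveInt.ψ m).evalEval a.a₂ 0) :
    ‖Dh.pairing (m • a.markedPoint₁ h) (m • a.markedPoint₁ h) -
        padicLog 3 (((a.curveInt.φ m).evalEval a.a₂ 0 : ℤ) : ℚ_[3])‖ ≤
      ‖(((a.curveInt.ψ m).evalEval a.a₂ 0 : ℤ) : ℚ_[3])‖ ^ 2 := by
  obtain ⟨h', e'⟩ := params_markedPoint₁_eq_some_intCast h
  rw [params_nsmul_eq_zsmul, e']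
  exact a.curveInt.norm_pairing_zsmul_self_sub_padicLog_φ_le_sq 3 le_rfl hσ hDh h' hΔ hψ h3

/-- **Second order for `P₂`**: `‖Dh.pairing (n • P₂) (n • P₂) − log₃ φₙ(P₂)‖₃ ≤ ‖ψₙ(P₂)‖₃²`.
[cite: Harvey2008, §5 (evaluation of log_p(σ_p(mQ)/d(mQ)); Lemma 8)] -/
theorem params_norm_pairing_nsmul_markedPoint₂_sub_padicLog_φ_le_sq
    (hσ : ∃ σ : PowerSeries ℚ_[3], ∃ c : ℚ_[3], (a.curve.baseChange ℚ_[3]).IsMazurTateSigmaPair σ c)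
    {Dh : PAdicHeightData a.curve 3} (hDh : Dh.IsCanonical)
    (hΔ : ∀ ℓ : ℕ, ℓ.Prime → ¬ (ℓ : ℤ) ^ 2 ∣ a.curveInt.Δ) (h : a.IsMember) {n : ℕ}
    (hψ : (a.curveInt.ψ n).evalEval a.a₂' 0 ≠ 0) (h3 : (3 : ℤ) ∣ (a.curveInt.ψ n).evalEval a.a₂' 0) :
    ‖Dh.pairing (n • a.markedPoint₂ h) (n • a.markedPoint₂ h) -
        padicLog 3 (((a.curveInt.φ n).evalEval a.a₂' 0 : ℤ) : ℚ_[3])‖ ≤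
      ‖(((a.curveInt.ψ n).evalEval a.a₂' 0 : ℤ) : ℚ_[3])‖ ^ 2 := by
  obtain ⟨h', e'⟩ := params_markedPoint₂_eq_some_intCast h
  rw [params_nsmul_eq_zsmul, e']
  exact a.curveInt.norm_pairing_zsmul_self_sub_padicLog_φ_le_sq 3 le_rfl hσ hDh h' hΔ hψ h3

/-! ### The digit clauses of `stub_heightDigits` -/

/-- **First clause of `stub_heightDigits` (digit of `⟨mP₁, mP₁⟩`)**: for a type-∅ member with a
Mazur–Tate pair over `ℚ₃`, `Dh` canonical, `m : ℕ` with `3 ∣ ψₘ(P₁) ≠ 0` and `d : ℤ` with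
`9 ∣ φₘ(P₁)² − 1 − 6d`: `‖Dh.pairing (m • P₁) (m • P₁) / 3 − d‖₃ < 1`. (For `m = 2` on the class
`a ≡ (7,0,4,0) mod 9`: `φ₂(P₁) ≡ ±4`, `d = 1`.) [cite: Balakrishnan2016, §2 eq. (2.3)] -/
theorem params_norm_pairing_nsmul_markedPoint₁_div_three_sub_lt
    (hσ : ∃ σ : PowerSeries ℚ_[3], ∃ c : ℚ_[3], (a.curve.baseChange ℚ_[3]).IsMazurTateSigmaPair σ c)
    {Dh : PAdicHeightData a.curve 3} (hDh : Dh.IsCanonical)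
    (hΔ : ∀ ℓ : ℕ, ℓ.Prime → ¬ (ℓ : ℤ) ^ 2 ∣ a.curveInt.Δ) (h : a.IsMember) {m : ℕ}
    (hψ : (a.curveInt.ψ m).evalEval a.a₂ 0 ≠ 0) (h3 : (3 : ℤ) ∣ (a.curveInt.ψ m).evalEval a.a₂ 0)
    (d : ℤ) (hd : (9 : ℤ) ∣ (a.curveInt.φ m).evalEval a.a₂ 0 ^ 2 - 1 - 6 * d) :
    ‖Dh.pairing (m • a.markedPoint₁ h) (m • a.markedPoint₁ h) / 3 - (d : ℚ_[3])‖ < 1 := by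
  obtain ⟨h', e'⟩ := params_markedPoint₁_eq_some_intCast h
  rw [params_nsmul_eq_zsmul, e']
  exact a.curveInt.norm_pairing_zsmul_self_three_div_sub_lt hσ hDh h' hΔ hψ h3 d hd

/-- **Second clause of `stub_heightDigits` (digit of `⟨nP₂, nP₂⟩`)**: same with `P₂ = (a₂', 0)`;
`9 ∣ φₙ(P₂)² − 1 − 6d ⇒ ‖Dh.pairing (n • P₂) (n • P₂) / 3 − d‖₃ < 1`. (For `n = 3` on the class
`a ≡ (7,0,4,0) mod 9`: `φ₃(P₂) ≡ ±2`, `d = 2`.) [cite: Balakrishnan2016, §2 eq. (2.3)] -/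
theorem params_norm_pairing_nsmul_markedPoint₂_div_three_sub_lt
    (hσ : ∃ σ : PowerSeries ℚ_[3], ∃ c : ℚ_[3], (a.curve.baseChange ℚ_[3]).IsMazurTateSigmaPair σ c)
    {Dh : PAdicHeightData a.curve 3} (hDh : Dh.IsCanonical)
    (hΔ : ∀ ℓ : ℕ, ℓ.Prime → ¬ (ℓ : ℤ) ^ 2 ∣ a.curveInt.Δ) (h : a.IsMember) {n : ℕ}
    (hψ : (a.curveInt.ψ n).evalEval a.a₂' 0 ≠ 0) (h3 : (3 : ℤ) ∣ (a.curveInt.ψ n).evalEval a.a₂' 0)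
    (d : ℤ) (hd : (9 : ℤ) ∣ (a.curveInt.φ n).evalEval a.a₂' 0 ^ 2 - 1 - 6 * d) :
    ‖Dh.pairing (n • a.markedPoint₂ h) (n • a.markedPoint₂ h) / 3 - (d : ℚ_[3])‖ < 1 := by
  obtain ⟨h', e'⟩ := params_markedPoint₂_eq_some_intCast h
  rw [params_nsmul_eq_zsmul, e']
  exact a.curveInt.norm_pairing_zsmul_self_three_div_sub_lt hσ hDh h' hΔ hψ h3 d hd

/-- **The whole height conjunction of `stub_heightDigits` for ONE member**, verbatim: for a type-∅
member `a` on the door class `a ≡ (1, 0, 1, 0) (mod 3)` (so `3 ∣ ψ₂(P₁)`, `3 ∣ ψ₃(P₂)`,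
`params_three_dvd_ψ_two_markedPoint₁`, `…_three_markedPoint₂`) with a Mazur–Tate pair over `ℚ₃`, a
canonical datum `Dh`, `ψ₂(P₁) ≠ 0`, `ψ₃(P₂) ≠ 0`, and digits `dA, dB` with `dA·dB ≡ 2 (mod 3)`,
`9 ∣ φ₂(P₁)² − 1 − 6dA`, `9 ∣ φ₃(P₂)² − 1 − 6dB` (all four are polynomial (in)congruences in `a`; on the
certificate class `(7,0,4,0) mod 9`: `(dA, dB) = (1, 2)`). The third conjunct is the denominator seat's
`params_norm_pairing_crossTerm_le` (Mazur–Tate 1983 integrality; no pair needed there).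
[cite: Balakrishnan2016, §2 eq. (2.3)] -/
theorem params_exists_heightDigits
    (hσ : ∃ σ : PowerSeries ℚ_[3], ∃ c : ℚ_[3], (a.curve.baseChange ℚ_[3]).IsMazurTateSigmaPair σ c)
    {Dh : PAdicHeightData a.curve 3} (hDh : Dh.IsCanonical)
    (hΔ : ∀ ℓ : ℕ, ℓ.Prime → ¬ (ℓ : ℤ) ^ 2 ∣ a.curveInt.Δ) (h : a.IsMember)
    (h₁ : (a.a₁ : ZMod 3) = 1) (h₂ : (a.a₂ : ZMod 3) = 0) (h₂' : (a.a₂' : ZMod 3) = 1)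
    (h₃ : (a.a₃ : ZMod 3) = 0)
    (hψ₁ : (a.curveInt.ψ 2).evalEval a.a₂ 0 ≠ 0) (hψ₂ : (a.curveInt.ψ 3).evalEval a.a₂' 0 ≠ 0)
    {dA dB : ℤ} (hAB : dA * dB % 3 = 2)
    (hdA : (9 : ℤ) ∣ (a.curveInt.φ 2).evalEval a.a₂ 0 ^ 2 - 1 - 6 * dA)
    (hdB : (9 : ℤ) ∣ (a.curveInt.φ 3).evalEval a.a₂' 0 ^ 2 - 1 - 6 * dB) :
    ∃ dA dB : ℤ, dA * dB % 3 = 2 ∧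
      ‖Dh.pairing (2 • a.markedPoint₁ h) (2 • a.markedPoint₁ h) / 3 - dA‖ < 1 ∧
      ‖Dh.pairing (3 • a.markedPoint₂ h) (3 • a.markedPoint₂ h) / 3 - dB‖ < 1 ∧
      ‖Dh.pairing (2 • a.markedPoint₁ h + 3 • a.markedPoint₂ h)
          (2 • a.markedPoint₁ h + 3 • a.markedPoint₂ h)‖ ≤ (3 : ℝ)⁻¹ := by
  have hd₂ : (3 : ℤ) ∣ a.a₂ := by exact_mod_cast (ZMod.intCast_zmod_eq_zero_iff_dvd a.a₂ 3).mp h₂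
  have hd₃ : (3 : ℤ) ∣ a.a₃ := by exact_mod_cast (ZMod.intCast_zmod_eq_zero_iff_dvd a.a₃ 3).mp h₃
  have h3₁ : (3 : ℤ) ∣ (a.curveInt.ψ (2 : ℕ)).evalEval a.a₂ 0 := by
    exact_mod_cast params_three_dvd_ψ_two_markedPoint₁ a hd₂ hd₃
  have h3₂ : (3 : ℤ) ∣ (a.curveInt.ψ (3 : ℕ)).evalEval a.a₂' 0 := by
    exact_mod_cast params_three_dvd_ψ_three_markedPoint₂ a h₁ h₂ h₂' h₃
  have hψ₁' : (a.curveInt.ψ (2 : ℕ)).evalEval a.a₂ 0 ≠ 0 := by exact_mod_cast hψ₁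
  have hψ₂' : (a.curveInt.ψ (3 : ℕ)).evalEval a.a₂' 0 ≠ 0 := by exact_mod_cast hψ₂
  have hdA' : (9 : ℤ) ∣ (a.curveInt.φ (2 : ℕ)).evalEval a.a₂ 0 ^ 2 - 1 - 6 * dA := by exact_mod_cast hdA
  have hdB' : (9 : ℤ) ∣ (a.curveInt.φ (3 : ℕ)).evalEval a.a₂' 0 ^ 2 - 1 - 6 * dB := by
    exact_mod_cast hdB
  exact ⟨dA, dB, hAB,
    params_norm_pairing_nsmul_markedPoint₁_div_three_sub_lt hσ hDh hΔ h hψ₁' h3₁ dA hdA',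
    params_norm_pairing_nsmul_markedPoint₂_div_three_sub_lt hσ hDh hΔ h hψ₂' h3₂ dB hdB',
    params_norm_pairing_crossTerm_le hΔ h h₁ h₂ h₂' h₃ hDh⟩

/-! ### The Mazur–Tate pair at `3` from the route's published input -/

/-- The pair hypothesis of the lemmas above from the named fact `mazur_tate_sigma_exists_odd`
(Mazur–Tate 1991 Thm. 3.1 / Mazur–Stein–Tate 2006 Thm. 1.3 / Balakrishnan 2016 (2.3), "`p` odd";
conjunct 2 of `PublishedInputsAtThree`), for a member whose model `a.curve` is globally minimal with
good ordinary reduction at `3`. CONDITIONAL on that fact (its only content beyond the tree theorem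
`mazur_tate_sigma_existsUnique_holds`, `p ≥ 5`, is `p = 3`). [cite: MazurSteinTate2006, Thm. 1.3] -/
theorem params_exists_isMazurTateSigmaPair_of_odd (hex : mazur_tate_sigma_exists_odd) (a : Params)
    [a.curve.IsElliptic] [a.curve.IsGloballyMinimal] (hgood : a.curve.HasGoodReductionAtPrime 3)
    (hord : ¬ ((3 : ℕ) : ℤ) ∣ a.curve.frobeniusTrace 3) :
    ∃ σ : PowerSeries ℚ_[3], ∃ c : ℚ_[3], (a.curve.baseChange ℚ_[3]).IsMazurTateSigmaPair σ c :=
  hex a.curve 3 (by decide) hgood hord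

end Summit.BirchSwinnertonDyer.BirchSwinnertonDyer.Theorems

end
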